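import Mathlib
import HarnessLib
import Summits.HubbardSuperconductivity.HubbardSuperconductivity.Theorems.KLProgrammeKLRegimeEngineV8E5PointAugmentOverlapModel
import Summits.HubbardSuperconductivity.HubbardSuperconductivity.Theorems.KLProgrammeKLRegimeEngineV8E5BlockTrivial

/-!
# Route `KLProgramme` — ENGINE child gen 8 (stmt-HubbardSuperconductivity-20437 `KLRegimeEngineV17F2`), SKELETON v2 class #3, (RA-U) SUPPLIER part 4,
# input 3 for the SMALL steps (trivial INPUT pair, point-augmented OUTPUT family): overlap rows of `E(pointAugment F′ e)·S(G)` with a PLAIN fat family `G`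
# (cell gate-hubbard-kl, seat p5 g14; memo HOME/prover-p5/g11/RA-U-SUPPLY-g11.md §7.2 «n = 3 (terms 2/4) and n = 3, 4 (term 3): trivial input pair, output F⁺_{n−2}»)

The trivial-input doors `carrier_*_trivial_le` (…E5CarrierDoorsTrivialInput) read `hrow′/hcol′` of `E(F′)·S(trivialMultiplier)` for an ARBITRARY output family
`F′`; in the (RA-U) composition at the small steps `F′ = pointAugment (klAnisoFamily (n−2)) (klE5ExtMomenta Qm x y)` — the THIN side is point-augmented, the fat
side is NOT.  Twin of …E5PointAugmentOverlap §3 for this half-augmented shape: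

* `overlap_pointAugment_augLeg_left` — old thin rows are the plain rows (`(E(F′⁺)S(G)) (augLeg Y″) X′ = (E(F′)S(G)) Y″ X′`);
* **`rowSum_overlap_pointAugment_left_le`** — `Σ_{X′} ‖(E(F′⁺)S(G)) X″ X′‖ ≤ cr + ρ₁·ε⁻¹` (old rows `cr`; point rows factor through `ψ̂_{e_j}`: `ρ₁·ε⁻¹`,
  `ρ₁` = multiplicity of `G`, `‖G‖ ≤ 1`, `‖P_j‖ ≤ 1` from `‖F′‖ ≤ 1`, `‖1 − ΣF′‖ ≤ 1`);
* **`colSum_overlap_pointAugment_left_le`** — `Σ_{X″} ‖(E(F′⁺)S(G)) X″ X′‖ ≤ cc + q·ε⁻¹`;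
* **`overlapRows_pointAugment_klAniso_trivial`** — the model instance `F′ = klAnisoFamily … K klE0 J′`, `G = trivialMultiplier` (`ρ₁ = 1`: `card_filter_trivialMultiplier_ne_zero_le`, …E5BlockTrivial): plain `(cr, cc)` of
  `E(klAnisoFamily J′)·S(1)` ⟹ `(cr + (imagTimeWeight β M)⁻¹, cc + q·(imagTimeWeight β M)⁻¹)` on `E(pointAugment (klAnisoFamily J′) e)·S(1)`, any frame, `β > 0`.
  What stays INPUT here is the plain pair `(cr, cc)` of `E(klAnisoFamily J′)·S(1)` at the three fixed levels `J′ ≤ 2` — a single-multiplier `ℓ¹` character sum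
  `(βL²)⁻¹‖F̌_{J′,ω}‖₁` (located item «(RA-U)-SMALL-N-ROWS», (L2) lane).

`ε⁻¹ := ‖(βL²)⁻¹‖·|SpaceTimeIdx| = (imagTimeWeight β M)⁻¹` (`overlapEpsInv_eq`).  Everything is proved; no definitions; no named facts; nothing about the
model's sizes is asserted; nothing asserts superconductivity. [cite: BenfattoGiulianiMastropietro2006, §2.7 (2.71a)]
-/

noncomputable section

namespace Summit.HubbardSuperconductivity.HubbardSuperconductivity.Theorems.KLRegimeSplit

set_option linter.dupNamespace false -- summit = problem name (single-conjunct summit), D-0017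

open Real Finset Literature.MathematicalPhysics.QuantumLattice Literature.Probability.LatticeModels Matrix
open Summit.HubbardSuperconductivity.HubbardSuperconductivity.Theorems.KLProgrammeLegKernels
open Summit.HubbardSuperconductivity.HubbardSuperconductivity.Theorems.KLRegimeWick
open Summit.HubbardSuperconductivity.HubbardSuperconductivity.Theorems.TorusFourierL2

/-! ## §1 Thin side augmented, fat side plain -/

section HalfAugmented

variable {L M N N' q : ℕ} [NeZero L] (β : ℝ) (F' : Fin N' → FreqMomentum L M → ℂ) (G : Fin N → FreqMomentum L M → ℂ) (e : Fin q → FreqMomentum L M)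

/-- **Old thin rows against a plain fat family are the plain rows.** [cite: BenfattoGiulianiMastropietro2006, §2.7 (2.71)] -/
theorem overlap_pointAugment_augLeg_left (Y'' : SpaceTimeIdx L M × SectorLeg N') (X' : SpaceTimeIdx L M × SectorLeg N) :
    (sectorAnalysisMatrix L M β (pointAugment F' e) * sectorSubMatrix L M β G) (augLeg Y'') X' =
      (sectorAnalysisMatrix L M β F' * sectorSubMatrix L M β G) Y'' X' := by
  simp only [sectorAnalysis_mul_sectorSub_apply, augLeg, pointAugment_castAdd]

/-- **ROW SUMS, thin side augmented**: `Σ_{X′} ‖(E(F′⁺)S(G)) X″ X′‖ ≤ cr + ρ₁·‖(βL²)⁻¹‖·|SpaceTimeIdx|` (old rows `≤ cr`; a point row factors through `ψ̂_{e_j}`: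
`≤ ‖P_j(e_j)‖·Σ_{X′}‖S(G) (e_j,σ,c) X′‖ ≤ ρ₁·ε⁻¹`). [cite: BenfattoGiulianiMastropietro2006, §2.7 (2.71a)] -/
theorem rowSum_overlap_pointAugment_left_le (hF' : ∀ ω k, ‖F' ω k‖ ≤ 1) (hR : ∀ k, ‖1 - ∑ ω, F' ω k‖ ≤ 1) (hG : ∀ ω k, ‖G ω k‖ ≤ 1)
    {ρ₁ : ℕ} (hρ₁ : ∀ k : FreqMomentum L M, ((univ : Finset (Fin N)).filter fun ω => G ω k ≠ 0).card ≤ ρ₁) {cr : ℝ} (hcr0 : 0 ≤ cr)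
    (hcr : ∀ Y'' : SpaceTimeIdx L M × SectorLeg N', ∑ X' : SpaceTimeIdx L M × SectorLeg N,
      ‖(sectorAnalysisMatrix L M β F' * sectorSubMatrix L M β G) Y'' X'‖ ≤ cr)
    (X'' : SpaceTimeIdx L M × SectorLeg (N' + q)) :
    ∑ X' : SpaceTimeIdx L M × SectorLeg N, ‖(sectorAnalysisMatrix L M β (pointAugment F' e) * sectorSubMatrix L M β G) X'' X'‖ ≤
      cr + (ρ₁ : ℝ) * (‖((1 / (β * (L : ℝ) ^ 2) : ℝ) : ℂ)‖ * Fintype.card (SpaceTimeIdx L M)) := by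
  classical
  have hεi : 0 ≤ ‖((1 / (β * (L : ℝ) ^ 2) : ℝ) : ℂ)‖ * (Fintype.card (SpaceTimeIdx L M) : ℝ) := by positivity
  by_cases hX : X'' ∈ (univ : Finset _).map (augLegEmb (N := N') (q := q))
  · obtain ⟨Y'', -, rfl⟩ := mem_map.1 hX
    simp only [augLegEmb_apply, overlap_pointAugment_augLeg_left]
    exact (hcr Y'').trans (le_add_of_nonneg_right (mul_nonneg (Nat.cast_nonneg _) hεi))
  · obtain ⟨j, hj⟩ := exists_natAdd_of_not_mem_map X'' hX
    obtain ⟨x'', ⟨⟨ω, σ⟩, c⟩⟩ := X''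
    simp only at hj
    subst hj
    have hfac : ∀ X' : SpaceTimeIdx L M × SectorLeg N,
        ‖(sectorAnalysisMatrix L M β (pointAugment F' e) * sectorSubMatrix L M β G) (x'', ((Fin.natAdd N' j, σ), c)) X'‖ ≤
          ‖sectorSubMatrix L M β G ((e j, σ), c) X'‖ := by
      intro X'
      rw [sectorAnalysis_mul_sectorSub_apply_of_single_left β _ _ (pointAugment_natAdd_eq_zero_of_ne F' e j) x'' σ c X', norm_mul]
      refine mul_le_of_le_one_left (norm_nonneg _) ?_
      rw [norm_sectorAnalysisMatrix_apply_diag]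
      exact norm_pointAugment_le_one F' e hF' hR _ _
    refine (sum_le_sum fun X' _ => hfac X').trans ?_
    calc ∑ X' : SpaceTimeIdx L M × SectorLeg N, ‖sectorSubMatrix L M β G ((e j, σ), c) X'‖
        ≤ (‖((1 / (β * (L : ℝ) ^ 2) : ℝ) : ℂ)‖ * Fintype.card (SpaceTimeIdx L M)) * (ρ₁ : ℝ) := sum_norm_sectorSubMatrix_le β G hG hρ₁ _
      _ ≤ _ := by rw [mul_comm]; exact le_add_of_nonneg_left hcr0

/-- **COLUMN SUMS, thin side augmented**: `Σ_{X″} ‖(E(F′⁺)S(G)) X″ X′‖ ≤ cc + q·‖(βL²)⁻¹‖·|SpaceTimeIdx|` (old rows of the column `≤ cc`; each of the `q` point rows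
contributes `≤ ‖(βL²)⁻¹‖` per space-time point). [cite: BenfattoGiulianiMastropietro2006, §2.7 (2.71a)] -/
theorem colSum_overlap_pointAugment_left_le (hF' : ∀ ω k, ‖F' ω k‖ ≤ 1) (hR : ∀ k, ‖1 - ∑ ω, F' ω k‖ ≤ 1) (hG : ∀ ω k, ‖G ω k‖ ≤ 1)
    {cc : ℝ} (hcc : ∀ X' : SpaceTimeIdx L M × SectorLeg N, ∑ Y'' : SpaceTimeIdx L M × SectorLeg N',
      ‖(sectorAnalysisMatrix L M β F' * sectorSubMatrix L M β G) Y'' X'‖ ≤ cc)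
    (X' : SpaceTimeIdx L M × SectorLeg N) :
    ∑ X'' : SpaceTimeIdx L M × SectorLeg (N' + q), ‖(sectorAnalysisMatrix L M β (pointAugment F' e) * sectorSubMatrix L M β G) X'' X'‖ ≤
      cc + (q : ℝ) * (‖((1 / (β * (L : ℝ) ^ 2) : ℝ) : ℂ)‖ * Fintype.card (SpaceTimeIdx L M)) := by
  classical
  rw [sum_sectorLegAug_split]
  have h1 : ∑ Y'' : SpaceTimeIdx L M × SectorLeg N', ‖(sectorAnalysisMatrix L M β (pointAugment F' e) * sectorSubMatrix L M β G) (augLeg Y'') X'‖ ≤ cc := by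
    simp only [overlap_pointAugment_augLeg_left]
    exact hcc X'
  have h2 : ∀ (x'' : SpaceTimeIdx L M) (j : Fin q), ∑ σ : Fin 2, ∑ c : Fin 2,
      ‖(sectorAnalysisMatrix L M β (pointAugment F' e) * sectorSubMatrix L M β G) (x'', ((Fin.natAdd N' j, σ), c)) X'‖ ≤
        ‖((1 / (β * (L : ℝ) ^ 2) : ℝ) : ℂ)‖ := by
    intro x'' j
    rw [sum_spin_charge_eq_single _ X'.2.1.2 X'.2.2 fun σ c h => by
      rw [sectorAnalysis_mul_sectorSub_apply_of_not β _ _ _ _ (fun h' : X'.2.1.2 = σ ∧ X'.2.2 = c => h ⟨h'.1.symm, h'.2.symm⟩), norm_zero]]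
    obtain ⟨x', ⟨⟨ω', σ'⟩, c'⟩⟩ := X'
    rw [sectorAnalysis_mul_sectorSub_apply_of_single_left β _ _ (pointAugment_natAdd_eq_zero_of_ne F' e j) x'' _ _ _, norm_mul]
    calc _ ≤ 1 * (‖((1 / (β * (L : ℝ) ^ 2) : ℝ) : ℂ)‖ * 1) := by
          refine mul_le_mul ?_ ?_ (norm_nonneg _) zero_le_one
          · rw [norm_sectorAnalysisMatrix_apply_diag]; exact norm_pointAugment_le_one F' e hF' hR _ _
          · exact (norm_sectorSubMatrix_apply_le_mul β _ _ _).trans (mul_le_mul_of_nonneg_left (hG _ _) (norm_nonneg _))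
      _ = _ := by ring
  have h3 : ∑ x'' : SpaceTimeIdx L M, ∑ j : Fin q, ∑ σ : Fin 2, ∑ c : Fin 2,
      ‖(sectorAnalysisMatrix L M β (pointAugment F' e) * sectorSubMatrix L M β G) (x'', ((Fin.natAdd N' j, σ), c)) X'‖ ≤
        (q : ℝ) * (‖((1 / (β * (L : ℝ) ^ 2) : ℝ) : ℂ)‖ * Fintype.card (SpaceTimeIdx L M)) := by
    calc _ ≤ ∑ _x'' : SpaceTimeIdx L M, ∑ _j : Fin q, ‖((1 / (β * (L : ℝ) ^ 2) : ℝ) : ℂ)‖ :=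
          sum_le_sum fun x'' _ => sum_le_sum fun j _ => h2 x'' j
      _ = (q : ℝ) * (‖((1 / (β * (L : ℝ) ^ 2) : ℝ) : ℂ)‖ * Fintype.card (SpaceTimeIdx L M)) := by
          rw [sum_const, sum_const, card_univ, card_univ, Fintype.card_fin, nsmul_eq_mul, nsmul_eq_mul]
          ring
  linarith

end HalfAugmented

/-! ## §2 The model instance with the trivial fat family -/

section Model

variable {L M : ℕ} [NeZero L] [NeZero M]

/-- **THE SMALL-STEP OVERLAP ROWS OF THE MODEL, thin side augmented** (steps with the trivial input pair and output `F⁺_{J′}`): plain `(cr, cc)` of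
`E(klAnisoFamily J′)·S(trivialMultiplier)` ⟹ `hrow′` with `cr + (imagTimeWeight β M)⁻¹` and `hcol′` with `cc + q·(imagTimeWeight β M)⁻¹` on
`E(pointAugment (klAnisoFamily J′) e)·S(trivialMultiplier)`, any frame `K`, `β > 0`, any `e : Fin q → FreqMomentum`. [cite: BenfattoGiulianiMastropietro2006, §2.7 (2.71a)] -/
theorem overlapRows_pointAugment_klAniso_trivial {β : ℝ} (hβ : 0 < β) (μ : ℝ) (K : TrigPolyC4v) (J' : ℕ) {q : ℕ} (e : Fin q → FreqMomentum L M)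
    {cr cc : ℝ} (hcr0 : 0 ≤ cr)
    (hcr : ∀ Y'' : SpaceTimeIdx L M × SectorLeg (sectorCount J'), ∑ X' : SpaceTimeIdx L M × SectorLeg 1,
      ‖(sectorAnalysisMatrix L M β (klAnisoFamily L M β μ K klE0 J') * sectorSubMatrix L M β (trivialMultiplier L M)) Y'' X'‖ ≤ cr)
    (hcc : ∀ X' : SpaceTimeIdx L M × SectorLeg 1, ∑ Y'' : SpaceTimeIdx L M × SectorLeg (sectorCount J'),
      ‖(sectorAnalysisMatrix L M β (klAnisoFamily L M β μ K klE0 J') * sectorSubMatrix L M β (trivialMultiplier L M)) Y'' X'‖ ≤ cc) :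
    (∀ X'' : SpaceTimeIdx L M × SectorLeg (sectorCount J' + q), ∑ X' : SpaceTimeIdx L M × SectorLeg 1,
      ‖(sectorAnalysisMatrix L M β (pointAugment (klAnisoFamily L M β μ K klE0 J') e) * sectorSubMatrix L M β (trivialMultiplier L M)) X'' X'‖ ≤
        cr + (imagTimeWeight β M)⁻¹) ∧
    (∀ X' : SpaceTimeIdx L M × SectorLeg 1, ∑ X'' : SpaceTimeIdx L M × SectorLeg (sectorCount J' + q),
      ‖(sectorAnalysisMatrix L M β (pointAugment (klAnisoFamily L M β μ K klE0 J') e) * sectorSubMatrix L M β (trivialMultiplier L M)) X'' X'‖ ≤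
        cc + q * (imagTimeWeight β M)⁻¹) := by
  have hε : ‖((1 / (β * (L : ℝ) ^ 2) : ℝ) : ℂ)‖ * (Fintype.card (SpaceTimeIdx L M) : ℝ) = (imagTimeWeight β M)⁻¹ :=
    overlapEpsInv_eq (L := L) (M := M) hβ
  refine ⟨fun X'' => ?_, fun X' => ?_⟩
  · have h := rowSum_overlap_pointAugment_left_le β (klAnisoFamily L M β μ K klE0 J') (trivialMultiplier L M) e (norm_klAnisoFamily_le_one β μ K J')
      (norm_one_sub_sum_klAnisoFamily_le_one β μ K J') norm_trivialMultiplier_le_one card_filter_trivialMultiplier_ne_zero_le hcr0 hcr X''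
    rw [hε, Nat.cast_one, one_mul] at h
    exact h
  · have h := colSum_overlap_pointAugment_left_le β (klAnisoFamily L M β μ K klE0 J') (trivialMultiplier L M) e (norm_klAnisoFamily_le_one β μ K J')
      (norm_one_sub_sum_klAnisoFamily_le_one β μ K J') norm_trivialMultiplier_le_one hcc X'
    rw [hε] at h
    exact h

end Model

end Summit.HubbardSuperconductivity.HubbardSuperconductivity.Theorems.KLRegimeSplit

end
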